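import Mathlib
import Summits.ResolutionOfSingularities.ResolutionOfSingularities.Theorems.HomologicalConductorPersistenceLostCertificate
import HarnessLib

/-!
# Crux `Persistence` (stmt-ResolutionOfSingularities-16484) — w44b U13: the KNÖRRER CERTIFICATE TRANSFER
# (a hypersurface certificate for `c` over the doubled factorisation of `x·y − h` descends to a certificate over `h`)

Route `ResolutionOfSingularities/HomologicalConductor`, chain W4.4b (cell `res-hironaka`), crux `Persistence`
(stmt-ResolutionOfSingularities-16484), §H2L / cA arena (CHAIN w44b v13: «the kernel half of the cA-ARENA enabling
formula and of R4's LOST side», U12-SPEC v2 §6 Cor. 3). OURS; nothing here is a statement of the manuscript under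
review (Hironaka 2017) and no statement of that manuscript is used; AI-written, weaker than expert review. Filed
`--supports stmt-ResolutionOfSingularities-16484 --as helper` by res-type-010 on res-L1-w44b-plan-1's CUT
2026-08-27T10:10:59Z (3) / 10:18:56Z («U13 := KNÖRRER CERTIFICATE TRANSFER»).

SETTING (def-free: the doubled matrices are carried as variables `Φ Ψ` with their defining equations `hΦ hΨ`
as hypotheses, so consumers instantiate by `rfl`). `S` a commutative ring, `S′` a commutative `S`-algebra
(`ι := algebraMap S S′`; think `S′ = S[x, y]`) with a ring RETRACTION `π : S′ →+* S` of `ι` KILLING `x, y : S′`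
(`π (ι s) = s`, `π x = π y = 0`; e.g. evaluation at `0`), and a MATRIX FACTORISATION `φ ψ : Matrix n n S` of
`h : S`: `φ ψ = h·1 = ψ φ`. KNÖRRER'S DOUBLING (Knörrer 1987; here only the polynomial identities are used):
`Φ := [[ι φ, −x], [y, −ι ψ]]`, `Ψ := [[−ι ψ, x], [−y, ι φ]]` (`Matrix.fromBlocks`, blocks `x • 1` etc.). Then:

* `knorrer_mul`, `knorrer_mul'` — **`Φ Ψ = Ψ Φ = (x y − ι h)·1`**: `(Φ, Ψ)` is a matrix factorisation of the
  suspended hypersurface `x y − h` (the sign is the one these blocks give; for `h − x y` negate one factor);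
* `map_retraction_knorrerPhi / Psi` — `π Φ = [[φ, 0], [0, −ψ]]`, `π Ψ = [[−ψ, 0], [0, φ]]`;
* **`certificate_of_knorrer_certificate`** — a CERTIFICATE for `ι c` over `(Φ, Ψ)`,
  `(ι c)·1 = G Ψ + Φ E` with `G, E : Matrix (n ⊕ n) (n ⊕ n) S′`, DESCENDS to a certificate for `c` over `(φ, ψ)`:
  `c·1 = G₀ ψ + φ E₀` with `G₀ = −π(G)₁₁`, `E₀ = π(E)₁₁` (apply `π` entrywise and read the `(1,1)` block);
  contrapositive `not_exists_knorrer_certificate`: NO certificate for `c` downstairs ⇒ NO certificate for `ι c`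
  upstairs;
* `det_mem_nonZeroDivisors_of_mul_eq_smul_one` — `φ ψ = f·1`, `f ∈ S⁰` ⇒ `det φ ∈ S⁰` (so the determinant
  hypothesis of the LOST criterion is automatic for every matrix factorisation of a non-zero-divisor);
* **`not_mem_cohomologyAnnihilatorOfDegree_knorrer`** — the corollary through res-D-pv-026's LOST criterion
  `LostCertificate.not_mem_cohomologyAnnihilatorOfDegree_of_not_exists_certificate` (p521040 = U10b ∘ U7c): for
  `S′` noetherian and `x y − ι h ∈ S′⁰`, if `c·1 = G₀ ψ + φ E₀` has NO solution over `S`, then the class of `ι c`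
  lies OUTSIDE `caᵐ(S′ ⧸ (x y − ι h))` for EVERY `m` (the `(n ⊕ n)`-indexed doubling is re-indexed to
  `Fin (n + n)` by `finSumFinEquiv` to meet the criterion's `Fin`-indexed shape). USE (plan-1): every curve-level
  non-solvability certificate over `C_h = S ⧸ (h)` yields «`c ∉ caⁿ(T)` for all `n`» on the threefold `x y = h`
  (U12 = the instance `h = z⁴`, `c = z²`; R4's LOST half).

References (mechanism only): H. Knörrer, *Cohen–Macaulay modules on hypersurface singularities I*, Invent. Math.
88 (1987) 153–164 (the doubled factorisation); D. Eisenbud, Trans. AMS 260 (1980) §5–6; res-L1-w44b-plan-1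
CHAIN w44b v13 / U12-SPEC v2 §6 (OURS).
-/

noncomputable section

-- single-problem summit: the doubled namespace component `ResolutionOfSingularities` is forced
set_option linter.dupNamespace false

namespace Summit.ResolutionOfSingularities.ResolutionOfSingularities.Theorems.HomologicalConductor.KnorrerTransfer

open Matrix
open Literature.RingTheory.CohomologyAnnihilator
open Summit.ResolutionOfSingularities.ResolutionOfSingularities.Theorems.HomologicalConductor.LostCertificate

universe u v

/-! ## Small matrix identities -/

section Small

variable {S : Type u} {S' : Type v} [CommRing S] [CommRing S'] {n : Type*} [DecidableEq n]

/-- `(c • 1).map π = π c • 1` for a ring map `π`. [folklore] -/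
theorem map_smul_one (π : S' →+* S) (c : S') :
    (c • (1 : Matrix n n S')).map π = π c • (1 : Matrix n n S) := by
  ext i j
  by_cases h : i = j
  · subst h; simp
  · simp [Matrix.one_apply_ne h]

/-- `(x • 1) * M = x • M`. [folklore] -/
theorem smul_one_mul' [Fintype n] (x : S') (M : Matrix n n S') : (x • (1 : Matrix n n S')) * M = x • M := by
  rw [Matrix.smul_mul, Matrix.one_mul]

/-- `M * (x • 1) = x • M`. [folklore] -/
theorem mul_smul_one' [Fintype n] (x : S') (M : Matrix n n S') : M * (x • (1 : Matrix n n S')) = x • M := by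
  rw [Matrix.mul_smul, Matrix.mul_one]

/-- The `(1,1)` block of `c • 1` on `n ⊕ n` is `c • 1`. [folklore] -/
theorem toBlocks₁₁_smul_one (c : S) :
    (c • (1 : Matrix (n ⊕ n) (n ⊕ n) S)).toBlocks₁₁ = c • (1 : Matrix n n S) := by
  rw [← Matrix.fromBlocks_one, Matrix.fromBlocks_smul, Matrix.toBlocks_fromBlocks₁₁]

end Small

/-! ## Knörrer's doubled factorisation of `x y − h` -/

section Knorrer

variable {S' : Type v} [CommRing S'] {n : Type*} [Fintype n] [DecidableEq n]

/-- **Knörrer's doubled pair is a matrix factorisation of `x y − h`** (first order): for `φ ψ = h·1 = ψ φ` over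
`S′` and `Φ = [[φ, −x], [y, −ψ]]`, `Ψ = [[−ψ, x], [−y, φ]]`, one has `Φ Ψ = (x y − h)·1`.
[cite: Knorrer1987, §2] -/
theorem knorrer_mul (φ ψ : Matrix n n S') (h : S') (hφψ : φ * ψ = h • (1 : Matrix n n S'))
    (hψφ : ψ * φ = h • (1 : Matrix n n S')) (x y : S') {Φ Ψ : Matrix (n ⊕ n) (n ⊕ n) S'}
    (hΦ : Φ = fromBlocks φ (-(x • (1 : Matrix n n S'))) (y • (1 : Matrix n n S')) (-ψ))
    (hΨ : Ψ = fromBlocks (-ψ) (x • (1 : Matrix n n S')) (-(y • (1 : Matrix n n S'))) φ) :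
    Φ * Ψ = (x * y - h) • (1 : Matrix (n ⊕ n) (n ⊕ n) S') := by
  subst hΦ hΨ
  rw [Matrix.fromBlocks_multiply, ← Matrix.fromBlocks_one, Matrix.fromBlocks_smul, smul_zero, sub_smul,
    mul_smul]
  congr 1 <;>
    simp only [Matrix.mul_neg, Matrix.neg_mul, neg_neg, smul_one_mul', mul_smul_one', hφψ, hψφ, smul_smul,
      mul_comm y x, smul_neg] <;>
    abel

/-- **Knörrer's doubled pair, second order**: `Ψ Φ = (x y − h)·1`. [cite: Knorrer1987, §2] -/
theorem knorrer_mul' (φ ψ : Matrix n n S') (h : S') (hφψ : φ * ψ = h • (1 : Matrix n n S'))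
    (hψφ : ψ * φ = h • (1 : Matrix n n S')) (x y : S') {Φ Ψ : Matrix (n ⊕ n) (n ⊕ n) S'}
    (hΦ : Φ = fromBlocks φ (-(x • (1 : Matrix n n S'))) (y • (1 : Matrix n n S')) (-ψ))
    (hΨ : Ψ = fromBlocks (-ψ) (x • (1 : Matrix n n S')) (-(y • (1 : Matrix n n S'))) φ) :
    Ψ * Φ = (x * y - h) • (1 : Matrix (n ⊕ n) (n ⊕ n) S') := by
  subst hΦ hΨ
  rw [Matrix.fromBlocks_multiply, ← Matrix.fromBlocks_one, Matrix.fromBlocks_smul, smul_zero, sub_smul,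
    mul_smul]
  congr 1 <;>
    simp only [Matrix.mul_neg, Matrix.neg_mul, neg_neg, smul_one_mul', mul_smul_one', hφψ, hψφ, smul_smul,
      mul_comm y x, smul_neg] <;>
    abel

/-! ## The certificate transfer along a ring map killing `x, y` -/

variable {S : Type u} [CommRing S]

omit [Fintype n] in
/-- Under a ring map `π : S′ → S` KILLING `x` and `y`, the doubled matrices become block-diagonal:
`π Ψ = [[−π ψ, 0], [0, π φ]]`. [folklore] -/
theorem map_knorrerPsi (π : S' →+* S) (φ ψ : Matrix n n S') (x y : S') (hx : π x = 0) (hy : π y = 0)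
    {Ψ : Matrix (n ⊕ n) (n ⊕ n) S'}
    (hΨ : Ψ = fromBlocks (-ψ) (x • (1 : Matrix n n S')) (-(y • (1 : Matrix n n S'))) φ) :
    Ψ.map π = fromBlocks (-(ψ.map π)) 0 0 (φ.map π) := by
  subst hΨ
  ext (i | i) (j | j)
  · simp
  · by_cases hij : i = j
    · subst hij; simp [hx]
    · simp [Matrix.one_apply_ne hij]
  · by_cases hij : i = j
    · subst hij; simp [hy]
    · simp [Matrix.one_apply_ne hij]
  · simp

omit [Fintype n] in
/-- … and `π Φ = [[π φ, 0], [0, −π ψ]]`. [folklore] -/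
theorem map_knorrerPhi (π : S' →+* S) (φ ψ : Matrix n n S') (x y : S') (hx : π x = 0) (hy : π y = 0)
    {Φ : Matrix (n ⊕ n) (n ⊕ n) S'}
    (hΦ : Φ = fromBlocks φ (-(x • (1 : Matrix n n S'))) (y • (1 : Matrix n n S')) (-ψ)) :
    Φ.map π = fromBlocks (φ.map π) 0 0 (-(ψ.map π)) := by
  subst hΦ
  ext (i | i) (j | j)
  · simp
  · by_cases hij : i = j
    · subst hij; simp [hx]
    · simp [Matrix.one_apply_ne hij]
  · by_cases hij : i = j
    · subst hij; simp [hy]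
    · simp [Matrix.one_apply_ne hij]
  · simp

/-- **KNÖRRER CERTIFICATE TRANSFER (OURS · w44b U13).** Let `π : S′ → S` be a ring map with `π x = π y = 0`,
`φ ψ : Matrix n n S′`, and `Φ = [[φ, −x], [y, −ψ]]`, `Ψ = [[−ψ, x], [−y, φ]]` the doubled pair. If `c·1 = G Ψ + Φ E`
for some `G, E : Matrix (n ⊕ n) (n ⊕ n) S′` (a CERTIFICATE for `c` over `(Φ, Ψ)`), then
`(π c)·1 = (−π G₁₁)·(π ψ) + (π φ)·(π E₁₁)` over `S` — a certificate for `π c` over `(π φ, π ψ)`: apply `π`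
entrywise and read the `(1,1)` block. [cite: Knorrer1987, §2] -/
theorem certificate_of_knorrer_certificate (π : S' →+* S) (φ ψ : Matrix n n S') (x y : S')
    (hx : π x = 0) (hy : π y = 0) {Φ Ψ : Matrix (n ⊕ n) (n ⊕ n) S'}
    (hΦ : Φ = fromBlocks φ (-(x • (1 : Matrix n n S'))) (y • (1 : Matrix n n S')) (-ψ))
    (hΨ : Ψ = fromBlocks (-ψ) (x • (1 : Matrix n n S')) (-(y • (1 : Matrix n n S'))) φ)
    {c : S'} {G E : Matrix (n ⊕ n) (n ⊕ n) S'} (hcert : c • (1 : Matrix (n ⊕ n) (n ⊕ n) S') = G * Ψ + Φ * E) :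
    π c • (1 : Matrix n n S) = -((G.map π).toBlocks₁₁) * ψ.map π + φ.map π * (E.map π).toBlocks₁₁ := by
  have h : (π.mapMatrix (c • (1 : Matrix (n ⊕ n) (n ⊕ n) S'))).toBlocks₁₁ =
      (π.mapMatrix (G * Ψ + Φ * E)).toBlocks₁₁ := by rw [hcert]
  rw [map_add, map_mul, map_mul, RingHom.mapMatrix_apply, RingHom.mapMatrix_apply, RingHom.mapMatrix_apply,
    RingHom.mapMatrix_apply, RingHom.mapMatrix_apply, map_smul_one, toBlocks₁₁_smul_one,
    map_knorrerPsi π φ ψ x y hx hy hΨ, map_knorrerPhi π φ ψ x y hx hy hΦ,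
    ← Matrix.fromBlocks_toBlocks (G.map π), ← Matrix.fromBlocks_toBlocks (E.map π),
    Matrix.fromBlocks_multiply, Matrix.fromBlocks_multiply, Matrix.fromBlocks_add,
    Matrix.toBlocks_fromBlocks₁₁] at h
  rw [h, Matrix.mul_zero, add_zero, Matrix.zero_mul, add_zero, Matrix.mul_neg, Matrix.neg_mul]

/-- **Contrapositive: NO small certificate downstairs ⇒ NO certificate upstairs.** If `π c·1 = G₀ (π ψ) + (π φ) E₀`
has no solution `G₀, E₀ : Matrix n n S`, then `c·1 = G Ψ + Φ E` has no solution over `S′`. [folklore] -/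
theorem not_exists_knorrer_certificate (π : S' →+* S) (φ ψ : Matrix n n S') (x y : S')
    (hx : π x = 0) (hy : π y = 0) {Φ Ψ : Matrix (n ⊕ n) (n ⊕ n) S'}
    (hΦ : Φ = fromBlocks φ (-(x • (1 : Matrix n n S'))) (y • (1 : Matrix n n S')) (-ψ))
    (hΨ : Ψ = fromBlocks (-ψ) (x • (1 : Matrix n n S')) (-(y • (1 : Matrix n n S'))) φ) (c : S')
    (hno : ¬ ∃ G₀ E₀ : Matrix n n S, π c • (1 : Matrix n n S) = G₀ * ψ.map π + φ.map π * E₀) :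
    ¬ ∃ G E : Matrix (n ⊕ n) (n ⊕ n) S', c • (1 : Matrix (n ⊕ n) (n ⊕ n) S') = G * Ψ + Φ * E := by
  rintro ⟨G, E, hGE⟩
  exact hno ⟨_, _, certificate_of_knorrer_certificate π φ ψ x y hx hy hΦ hΨ hGE⟩

end Knorrer

/-! ## Over an `S`-algebra with a retraction: the shape the chain uses (`S′ = S[x, y]`, `φ′ = ι φ`) -/

section Algebra

variable {S : Type u} {S' : Type v} [CommRing S] [CommRing S'] [Algebra S S']
variable {n : Type*} [Fintype n] [DecidableEq n]

omit [Fintype n] [DecidableEq n] in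
/-- `π (ι M) = M` entrywise for a retraction `π` of `ι = algebraMap S S′`. [folklore] -/
theorem map_map_retraction (π : S' →+* S) (hπ : ∀ s : S, π (algebraMap S S' s) = s) (M : Matrix n n S) :
    (M.map (algebraMap S S')).map π = M := by
  ext i j
  simp [hπ]

/-- **KNÖRRER CERTIFICATE TRANSFER, `S`-algebra form (OURS · w44b U13).** `S′` an `S`-algebra with a ring
retraction `π` of `ι = algebraMap S S′` killing `x, y : S′`; `φ ψ : Matrix n n S`; the doubled pair
`Φ = [[ι φ, −x], [y, −ι ψ]]`, `Ψ = [[−ι ψ, x], [−y, ι φ]]`. A certificate `(ι c)·1 = G Ψ + Φ E` over `S′` yields a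
certificate `c·1 = G₀ ψ + φ E₀` over `S` (`G₀ = −π G₁₁`, `E₀ = π E₁₁`). [cite: Knorrer1987, §2] -/
theorem certificate_of_knorrer_certificate_algebraMap (π : S' →+* S) (hπ : ∀ s : S, π (algebraMap S S' s) = s)
    (φ ψ : Matrix n n S) (x y : S') (hx : π x = 0) (hy : π y = 0) {Φ Ψ : Matrix (n ⊕ n) (n ⊕ n) S'}
    (hΦ : Φ = fromBlocks (φ.map (algebraMap S S')) (-(x • (1 : Matrix n n S'))) (y • (1 : Matrix n n S'))
      (-(ψ.map (algebraMap S S'))))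
    (hΨ : Ψ = fromBlocks (-(ψ.map (algebraMap S S'))) (x • (1 : Matrix n n S')) (-(y • (1 : Matrix n n S')))
      (φ.map (algebraMap S S'))) (c : S)
    (hcert : ∃ G E : Matrix (n ⊕ n) (n ⊕ n) S',
      algebraMap S S' c • (1 : Matrix (n ⊕ n) (n ⊕ n) S') = G * Ψ + Φ * E) :
    ∃ G₀ E₀ : Matrix n n S, c • (1 : Matrix n n S) = G₀ * ψ + φ * E₀ := by
  obtain ⟨G, E, hGE⟩ := hcert
  have h := certificate_of_knorrer_certificate π (φ.map (algebraMap S S')) (ψ.map (algebraMap S S')) x y hx hy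
    hΦ hΨ hGE
  rw [hπ, map_map_retraction π hπ, map_map_retraction π hπ] at h
  exact ⟨_, _, h⟩

/-- **Contrapositive, `S`-algebra form**: NO certificate for `c` over `(φ, ψ)` ⇒ NO certificate for `ι c` over the
doubled pair `(Φ, Ψ)`. [folklore] -/
theorem not_exists_knorrer_certificate_algebraMap (π : S' →+* S) (hπ : ∀ s : S, π (algebraMap S S' s) = s)
    (φ ψ : Matrix n n S) (x y : S') (hx : π x = 0) (hy : π y = 0) {Φ Ψ : Matrix (n ⊕ n) (n ⊕ n) S'}
    (hΦ : Φ = fromBlocks (φ.map (algebraMap S S')) (-(x • (1 : Matrix n n S'))) (y • (1 : Matrix n n S'))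
      (-(ψ.map (algebraMap S S'))))
    (hΨ : Ψ = fromBlocks (-(ψ.map (algebraMap S S'))) (x • (1 : Matrix n n S')) (-(y • (1 : Matrix n n S')))
      (φ.map (algebraMap S S'))) (c : S)
    (hno : ¬ ∃ G₀ E₀ : Matrix n n S, c • (1 : Matrix n n S) = G₀ * ψ + φ * E₀) :
    ¬ ∃ G E : Matrix (n ⊕ n) (n ⊕ n) S',
      algebraMap S S' c • (1 : Matrix (n ⊕ n) (n ⊕ n) S') = G * Ψ + Φ * E :=
  fun h => hno (certificate_of_knorrer_certificate_algebraMap π hπ φ ψ x y hx hy hΦ hΨ c h)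

/-- The doubled pair of a matrix factorisation `φ ψ = h·1 = ψ φ` over `S` is a matrix factorisation of
`x y − ι h` over `S′` (both orders). [cite: Knorrer1987, §2] -/
theorem knorrer_mul_algebraMap (φ ψ : Matrix n n S) (h : S) (hφψ : φ * ψ = h • (1 : Matrix n n S))
    (hψφ : ψ * φ = h • (1 : Matrix n n S)) (x y : S') {Φ Ψ : Matrix (n ⊕ n) (n ⊕ n) S'}
    (hΦ : Φ = fromBlocks (φ.map (algebraMap S S')) (-(x • (1 : Matrix n n S'))) (y • (1 : Matrix n n S'))
      (-(ψ.map (algebraMap S S'))))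
    (hΨ : Ψ = fromBlocks (-(ψ.map (algebraMap S S'))) (x • (1 : Matrix n n S')) (-(y • (1 : Matrix n n S')))
      (φ.map (algebraMap S S'))) :
    Φ * Ψ = (x * y - algebraMap S S' h) • (1 : Matrix (n ⊕ n) (n ⊕ n) S') ∧
      Ψ * Φ = (x * y - algebraMap S S' h) • (1 : Matrix (n ⊕ n) (n ⊕ n) S') := by
  have hφψ' : φ.map (algebraMap S S') * ψ.map (algebraMap S S') =
      algebraMap S S' h • (1 : Matrix n n S') := by
    rw [← Matrix.map_mul, hφψ, map_smul_one (algebraMap S S')]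
  have hψφ' : ψ.map (algebraMap S S') * φ.map (algebraMap S S') =
      algebraMap S S' h • (1 : Matrix n n S') := by
    rw [← Matrix.map_mul, hψφ, map_smul_one (algebraMap S S')]
  exact ⟨knorrer_mul _ _ _ hφψ' hψφ' x y hΦ hΨ, knorrer_mul' _ _ _ hφψ' hψφ' x y hΦ hΨ⟩

end Algebra

/-! ## The corollary through the LOST criterion: no small certificate ⇒ `ι c ∉ caᵐ(S′ ⧸ (x y − ι h))` -/

section Lost

variable {S S' : Type u} [CommRing S] [CommRing S'] [Algebra S S']

/-- `φ ψ = f·1` with `f` a non-zero-divisor ⇒ `det φ` is a non-zero-divisor (`det φ · det ψ = f ^ #m`).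
[folklore] -/
theorem det_mem_nonZeroDivisors_of_mul_eq_smul_one {m : Type*} [Fintype m] [DecidableEq m]
    {φ ψ : Matrix m m S'} {f : S'} (hφψ : φ * ψ = f • (1 : Matrix m m S')) (hf : f ∈ nonZeroDivisors S') :
    φ.det ∈ nonZeroDivisors S' := by
  have hdet : φ.det * ψ.det = f ^ Fintype.card m := by
    rw [← Matrix.det_mul, hφψ, Matrix.det_smul, Matrix.det_one, mul_one]
  have hpow : f ^ Fintype.card m ∈ nonZeroDivisors S' := pow_mem hf _
  rw [← hdet] at hpow
  exact (mul_mem_nonZeroDivisors.mp hpow).1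

/-- Re-indexing a certificate along an equivalence of index types. [folklore] -/
theorem exists_certificate_reindex_iff {m m' : Type*} [Fintype m] [DecidableEq m] [Fintype m'] [DecidableEq m']
    (e : m ≃ m') (Φ Ψ : Matrix m m S') (c : S') :
    (∃ G E : Matrix m' m' S', c • (1 : Matrix m' m' S') =
        G * Matrix.reindex e e Ψ + Matrix.reindex e e Φ * E) ↔
      ∃ G E : Matrix m m S', c • (1 : Matrix m m S') = G * Ψ + Φ * E := by
  -- the re-indexing is an algebra isomorphism `ρ`
  let ρ : Matrix m m S' ≃ₐ[S'] Matrix m' m' S' := Matrix.reindexAlgEquiv S' S' e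
  have hρ : ∀ M : Matrix m m S', Matrix.reindex e e M = ρ M := fun M => rfl
  constructor
  · rintro ⟨G, E, h⟩
    refine ⟨ρ.symm G, ρ.symm E, ?_⟩
    have h' := congrArg ρ.symm h
    rw [hρ, hρ, map_smul, map_one, map_add, map_mul, map_mul, ρ.symm_apply_apply, ρ.symm_apply_apply] at h'
    exact h'
  · rintro ⟨G, E, h⟩
    refine ⟨ρ G, ρ E, ?_⟩
    have h' := congrArg ρ h
    rw [map_smul, map_one, map_add, map_mul, map_mul] at h'
    rw [hρ, hρ]
    exact h'

/-- **NO small certificate ⇒ `ι c ∉ caᵐ(S′ ⧸ (x y − ι h))` for every `m` (OURS · w44b U13 ∘ U10b ∘ U7c).**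
`S′` a noetherian `S`-algebra with a ring retraction `π` of `ι = algebraMap S S′` killing `x, y`; `φ ψ = h·1 = ψ φ`
over `S` (`Fin n`-indexed); `x y − ι h ∈ S′⁰`. If `c·1 = G₀ ψ + φ E₀` has NO solution over `S`, then the class of
`ι c` does not lie in `caᵐ(S′ ⧸ (x y − ι h))` for any `m`: the doubled pair (re-indexed to `Fin (n + n)`) is a matrix
factorisation of `x y − ι h` with `det ∈ S′⁰`, it admits no certificate for `ι c`
(`not_exists_knorrer_certificate_algebraMap`), and res-D-pv-026's LOST criterion
`LostCertificate.not_mem_cohomologyAnnihilatorOfDegree_of_not_exists_certificate` (p521040) applies.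
[cite: Knorrer1987, §2] -/
theorem not_mem_cohomologyAnnihilatorOfDegree_knorrer [IsNoetherianRing S'] (π : S' →+* S)
    (hπ : ∀ s : S, π (algebraMap S S' s) = s) {n : ℕ} (φ ψ : Matrix (Fin n) (Fin n) S) (h : S)
    (hφψ : φ * ψ = h • (1 : Matrix (Fin n) (Fin n) S)) (hψφ : ψ * φ = h • (1 : Matrix (Fin n) (Fin n) S))
    (x y : S') (hx : π x = 0) (hy : π y = 0)
    (hf : x * y - algebraMap S S' h ∈ nonZeroDivisors S') (c : S)
    (hno : ¬ ∃ G₀ E₀ : Matrix (Fin n) (Fin n) S, c • (1 : Matrix (Fin n) (Fin n) S) = G₀ * ψ + φ * E₀)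
    (m : ℕ) :
    Ideal.Quotient.mk (Ideal.span ({x * y - algebraMap S S' h} : Set S')) (algebraMap S S' c) ∉
      cohomologyAnnihilatorOfDegree (S' ⧸ Ideal.span ({x * y - algebraMap S S' h} : Set S')) m := by
  set Φ : Matrix (Fin n ⊕ Fin n) (Fin n ⊕ Fin n) S' :=
    fromBlocks (φ.map (algebraMap S S')) (-(x • (1 : Matrix (Fin n) (Fin n) S'))) (y • 1)
      (-(ψ.map (algebraMap S S'))) with hΦ
  set Ψ : Matrix (Fin n ⊕ Fin n) (Fin n ⊕ Fin n) S' :=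
    fromBlocks (-(ψ.map (algebraMap S S'))) (x • (1 : Matrix (Fin n) (Fin n) S')) (-(y • 1))
      (φ.map (algebraMap S S')) with hΨ
  obtain ⟨hΦΨ, hΨΦ⟩ := knorrer_mul_algebraMap φ ψ h hφψ hψφ x y hΦ hΨ
  let e : Fin n ⊕ Fin n ≃ Fin (n + n) := finSumFinEquiv
  let ρ : Matrix (Fin n ⊕ Fin n) (Fin n ⊕ Fin n) S' ≃ₐ[S'] Matrix (Fin (n + n)) (Fin (n + n)) S' :=
    Matrix.reindexAlgEquiv S' S' e
  have hρ : ∀ M, Matrix.reindex e e M = ρ M := fun M => rfl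
  have hΦΨ' : Matrix.reindex e e Φ * Matrix.reindex e e Ψ =
      (x * y - algebraMap S S' h) • (1 : Matrix (Fin (n + n)) (Fin (n + n)) S') := by
    rw [hρ, hρ, ← map_mul, hΦΨ, map_smul, map_one]
  have hΨΦ' : Matrix.reindex e e Ψ * Matrix.reindex e e Φ =
      (x * y - algebraMap S S' h) • (1 : Matrix (Fin (n + n)) (Fin (n + n)) S') := by
    rw [hρ, hρ, ← map_mul, hΨΦ, map_smul, map_one]
  have hdet : (Matrix.reindex e e Φ).det ∈ nonZeroDivisors S' :=
    det_mem_nonZeroDivisors_of_mul_eq_smul_one hΦΨ' hf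
  have hcert : ¬ ∃ G E : Matrix (Fin (n + n)) (Fin (n + n)) S',
      algebraMap S S' c • (1 : Matrix (Fin (n + n)) (Fin (n + n)) S') =
        G * Matrix.reindex e e Ψ + Matrix.reindex e e Φ * E := by
    rw [exists_certificate_reindex_iff]
    exact not_exists_knorrer_certificate_algebraMap π hπ φ ψ x y hx hy hΦ hΨ c hno
  exact not_mem_cohomologyAnnihilatorOfDegree_of_not_exists_certificate (x * y - algebraMap S S' h) hf
    (Matrix.reindex e e Φ) (Matrix.reindex e e Ψ) hΦΨ' hΨΦ' hdet (algebraMap S S' c) hcert m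

end Lost

end Summit.ResolutionOfSingularities.ResolutionOfSingularities.Theorems.HomologicalConductor.KnorrerTransfer

end
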